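import Summits.QuantumFields.BalabanUV.T4Continuum.Support.U3PolymerDictionary

/-!
# U3 substrate — the polymer dictionary, DATA companion: THE LIFT of a domain activity to NE9's cube families

Cell `pub-balaban`, SUBSTRATE cell seat `b2b-balaban-substrate-p2` ([dict] identification layer; companion of
`Support/U3PolymerDictionary`).  Summits-side bookkeeping; the imported module supplies the theorems
(`clusterSum_cubeChart_eq`, `newTerm_cubeChart_eq`, `outB_eq_newTerm`, …) and is used BY NAME.

HONEST FRAMING (T4-DAG p. 1).  Rung (B)+1 of the FINITE-VOLUME T⁴ continuum programme — NOT infinite volume, NOT a mass gap, NOT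
the Clay problem, NOT a proof of NE5 or NE9 (neither is PRINTED).  HONEST DEPENDENCY (cell line, verbatim): continuum YM on T⁴ ⇐
BetaPertH ∧ nine spine estimates (0/9 proved); BetaPertH ⇐ (D1) ∧ (D4) ∧ CAP+tail; G-an2-4 gates asym, D1 and NE2/3/4.
DATA + bookkeeping only: 0 estimate, no `def … : Prop`, nothing of [Balaban1987RG1] ∕ [Balaban1988RG2Cluster] asserted.

WHAT THIS FILE DOES.  The theorems of `U3PolymerDictionary` are stated for any cube-family activity that READS a domain activity
on footprints.  Here the canonical such reading is DATA: `liftAct ρ` (the footprint of `Z` carries `ρ Z`, a cube family that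
is no footprint carries `0` — well defined by `footprint_injective`) and the family version `liftFam act` in NE9's argument
order `(k, s, U, Q, polymer)`; `liftAct_footprint`, `liftAct_of_not_mem_range`; **`clusterSum_liftAct`**, **`newTerm_liftFam`**
(NE9's `ClusterGeom.newTerm` of the lift on `(cubeChart R).geom` = NE5's (2.13) cluster sum, hard core of record), and
**`outB_eq_newTerm_liftFam`** ∕ `outA_eq_newTerm_liftFam` (route P2's represented outputs `clusterRep.outB ∕ outA` ARE NE9 new
terms of the lifted activity families, with NO matching hypothesis).  So an activity family typed ONCE on the domains of record
(NODE O's `act` slot, or route P2's `ρA ∕ ρB`) is, through `liftFam`, an `act` for NE9's END faces on the same carriers.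
[cite: Balaban1988RG2Cluster, (2.11)-(2.13) p.14] for the KIND of the object only.
-/

noncomputable section

open scoped BigOperators

namespace Summit.QuantumFields.BalabanUV.T4Continuum.U3PolymerDictionaryLift

open Literature.MathematicalPhysics.QuantumFieldTheory.Balaban1983to89
open Literature.MathematicalPhysics.QuantumFieldTheory.Balaban1983to89.T4ActivityLipschitz (clusterSum ClusterRep)
open Literature.MathematicalPhysics.QuantumFieldTheory.Balaban1983to89.T4HistoryLipschitzActivity (ClusterGeom)
open Literature.MathematicalPhysics.QuantumFieldTheory.Balaban1983to89.T4HistoryLipschitzCubeGeometry (CubeChart CubeInc)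
open Summit.QuantumFields.BalabanUV.T4Continuum.B13Carriers (TwoRuns)
open Summit.QuantumFields.BalabanUV.T4Continuum.B13DomainGeometryTR (SCube SAdj footprint domainGeometry)
open Summit.QuantumFields.BalabanUV.T4Continuum.B13CarriersCubeChart (cubeChart)
open Summit.QuantumFields.BalabanUV.T4Continuum.B13StepTermSocket (touchInc)
open Summit.QuantumFields.BalabanUV.T4Continuum.U3PolymerDictionary

variable {G : Type} [GaugeGroup G] {R : TwoRuns G}

open Classical in
/-- [folklore] **THE LIFT** of an activity on domains to an activity on cube families: the footprint of `Z` carries `ρ Z`, a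
cube family that is no footprint carries `0`. -/
def liftAct (ρ : R.carriers.Dom → ℂ) : Finset (SCube R) → ℂ := fun F =>
  if h : ∃ Z : R.carriers.Dom, footprint Z = F then ρ h.choose else 0

/-- [folklore] The lift reads `ρ` on footprints. -/
@[simp] theorem liftAct_footprint (ρ : R.carriers.Dom → ℂ) (Z : R.carriers.Dom) : liftAct ρ (footprint Z) = ρ Z := by
  classical
  have h : ∃ Z' : R.carriers.Dom, footprint Z' = footprint Z := ⟨Z, rfl⟩
  rw [liftAct, dif_pos h, footprint_injective h.choose_spec]

/-- [folklore] The lift vanishes off the footprints. -/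
theorem liftAct_of_not_mem_range (ρ : R.carriers.Dom → ℂ) {F : Finset (SCube R)} (hF : F ∉ Set.range (footprint (R := R))) :
    liftAct ρ F = 0 := by
  classical
  rw [liftAct, dif_neg]
  rintro ⟨Z, hZ⟩
  exact hF ⟨Z, hZ⟩

/-- [folklore] **ONE ACTIVITY INSTANCE SERVES BOTH ROWS**: NE9's localized cluster sum of the lifted activity is NE5's cluster sum
of the activity (hard core of record). -/
theorem clusterSum_liftAct (ρ : R.carriers.Dom → ℂ) (X : R.carriers.Dom) :
    clusterSum (CubeInc (SAdj R)) (liftAct ρ) ((cubeChart R).clus X) =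
      clusterSum (touchInc (domainGeometry R)) ρ ((domainGeometry R).clus X) := by
  rw [clusterSum_cubeChart_eq]
  simp only [liftAct_footprint]

/-- [folklore] The lift of a whole activity FAMILY in NE9's argument order `(k, s, U, Q, polymer)`. -/
def liftFam {Bg : Type} {Pot : Type*} (act : ℕ → ℝ → Bg → Pot → R.carriers.Dom → ℂ) :
    ℕ → ℝ → Bg → Pot → Finset (SCube R) → ℂ :=
  fun k s U Q => liftAct (act k s U Q)

/-- [folklore] **NE9's NEW TERM OF A LIFTED DOMAIN FAMILY** is NE5's (2.13) cluster sum of that family. -/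
theorem newTerm_liftFam {Bg : Type} {Pot : Type*} (act : ℕ → ℝ → Bg → Pot → R.carriers.Dom → ℂ)
    (k : ℕ) (s : ℝ) (U : Bg) (X : R.carriers.Dom) (Q : Pot) :
    (cubeChart R).geom.newTerm (liftFam act) k s U X Q =
      clusterSum (touchInc (domainGeometry R)) (act k s U Q) ((domainGeometry R).clus X) := by
  rw [newTerm_cubeChart_eq]
  simp only [liftFam, liftAct_footprint]

/-- [folklore] **ROUTE P2's OUTPUTS AS NE9 NEW TERMS OF THE LIFT** (no matching hypothesis): run B. -/
theorem outB_eq_newTerm_liftFam (ρA ρB : (ℕ → ℝ) → R.carriers.BgB → R.carriers.Dom → ℂ) (g : ℕ → ℝ)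
    (U : R.carriers.BgB) (X : R.carriers.Dom) (k : ℕ) (s : ℝ) :
    (B13DomainGeometryTR.clusterRep R ρA ρB).outB g U X =
      (cubeChart R).geom.newTerm (liftFam fun _ _ (V : R.carriers.BgB) (h : ℕ → ℝ) => ρB h V) k s U X g :=
  outB_eq_newTerm ρA ρB _ fun Z _ => by simp [liftFam]

/-- [folklore] Run A likewise. -/
theorem outA_eq_newTerm_liftFam (ρA ρB : (ℕ → ℝ) → R.carriers.BgB → R.carriers.Dom → ℂ) (g : ℕ → ℝ)
    (U : R.carriers.BgB) (X : R.carriers.Dom) (k : ℕ) (s : ℝ) :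
    (B13DomainGeometryTR.clusterRep R ρA ρB).outA g U X =
      (cubeChart R).geom.newTerm (liftFam fun _ _ (V : R.carriers.BgB) (h : ℕ → ℝ) => ρA h V) k s U X g :=
  outA_eq_newTerm ρA ρB _ fun Z _ => by simp [liftFam]


end Summit.QuantumFields.BalabanUV.T4Continuum.U3PolymerDictionaryLift

end
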